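import Summits.QuantumFields.YangMills.Theorems.FluctuationComparisonRegPrIntLS2BetaConeOnRectangle
import HarnessLib

/-!
# S2β · D-GUARD ∕ (BG∞) — STAGE T ON A BOX-BLOCK ((R3) of FINDING (BX) = (L-T) ✓p840047 re-cut over the cone on a discrete RECTANGLE ✓∕⧗(R2)): the section of a
# class-2 block with `(α, β)`-slices `{0..nα} × {0..nβ}` (`α` := the LONGER odd axis, `nβ ≤ nα ≤ 2nβ`), pinned by `hW : ∀ t, W t = Wr (slice datum of t) (t α, t β)`,
# with ring agreement, cap position, in-slice steps `≤ 12Λη + 6(π−r)∕nα` from PER-BOND ring oscillation `η`, across-slice steps `≤ Λμ` — binder style (RULING №127)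

Cell `ym3-torus` (YM ladder rung R3 = continuum `SU(2)` Yang–Mills on the three-torus at fixed lattice data — a RUNG: NOT d = 4, NOT infinite volume,
NOT a mass gap, NOT Clay).  Width seat «width 5» `ym3-torus-px5` (gen 24), FREE px helper on crux `stmt-QuantumFields-20520` (`FluctuationComparisonRegPrIntL`;
registry `Lines/semiclassical_s2beta.lean` UNTOUCHED, 0∕5); `--kind proof --supports stmt-QuantumFields-20520 --as helper`, count-neutral, DEFINITION-FREE
(0 `def`, 0 `instance`, 0 `notation`, 0 `sorry`, default heartbeats).  The rectangle operator `Wr` enters as a BINDER whose law `hWr` is the body of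
✓∕⧗`exists_coneOnRect nα nβ … a` VERBATIM (the assembler does `obtain ⟨Wr, hWr⟩ := exists_coneOnRect nα nβ hn hβα hαβ hr hrπ a` once per block).

WHY.  ✓p840047 (L-T) took ONE side `n` (square slices); by (BX) the blocks of `hSec` (✓p840037) are boxes with sides `len (Q κ) ∈ {c, c+1}`.  This file is (L-T) with
`t α ≤ nα`, `t β ≤ nβ` and the rectangle operator; since (R2)'s clause (iii′) takes the PER-BOND ring letters directly, the modulus detour of (L-T)
(`sliceModulus_of_ringSteps`) is replaced by the two forward-letter readers `sliceRing_h_of_ringSteps` ∕ `sliceRing_v_of_ringSteps`.  The offset algebra (§1 of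
✓p840047: `uu_*`, `slice_step_*`) is imported BY NAME.

WHAT IS PROVED (sorry-free; `Λ := (π − r)∕sin r`; «ring» = `u α ≤ nα ∧ u β ≤ nβ ∧ (u α = 0 ∨ u α = nα ∨ u β = 0 ∨ u β = nβ)`; «`u` in the slice of `t`» =
`update (update u α (t α)) β (t β) = t`; all hypotheses SLICE-LOCAL).
* §1 readers: `sliceCap_of_ringCap`, `sliceRing_h_of_ringSteps`, `sliceRing_v_of_ringSteps`.
* §2 OFFSET-LEVEL LAWS: ★ `stageT_ring_eq`, ★★ `norm_logVec_inv_stageT_le`, ★★★ `dist1_stageT_step_fst_le` ∕ `dist1_stageT_step_snd_le` (`≤ 12Λη + 6(π−r)∕nα`),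
  ★★★ `dist1_stageT_step_of_ne_le` (`≤ Λμ`).
* §3 BOND-LEVEL LAWS (`x : Site P j`, `b : PBond P j`, offsets `t(x) κ := (x κ − (s κ : ZMod N)).val`, no-wrap `hN` as in (L-I)∕(L-T)):
  ★★★ `dist1_stageT_inslice_le` (`b.dir = α ∨ b.dir = β`), ★★★ `dist1_stageT_transverse_le` (`b.dir ≠ α, β`).

HONEST SCOPE.  Composition of ✓∕⧗(R2) with offset bookkeeping (✓p839889, ✓p840047 §1); no gauge field; nothing of Bałaban's renormalisation-group analysis is asserted or
proved ([Balaban1985RegularSpaces] Lemma 1 p.79, (1.36) p.82, Thm 2 p.83 — local small gauges).  (BG∞) ∕ `hSec` ∕ `hsupp⁺` is a CONJECTURE (plan §116) and is NOT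
proved; (L-S)′(L-Σ) are OPEN; GAP♯∘ (`stub_uniformFibreGapOrbit`, registry UNTOUCHED), the five registered stubs (0∕5), S2β, 20520, 19936, 19200, `YM3TorusSU2` are
NOT proved; no registered stub is closed; rung R3 — NOT d = 4, NOT infinite volume, NOT a mass gap, NOT Clay; the Yang–Mills mass gap is NOT proved.  Axioms standard.

References: T. Bałaban, CMP **99** (1985) 75–102 [Balaban1985RegularSpaces] (Lemma 1 p.79, (1.36) p.82, Thm 2 p.83).
-/

set_option autoImplicit false

noncomputable section

namespace Summit.QuantumFields.YangMills.Theorems.FluctuationComparisonRegPrIntLS2BetaSqrtGaugeStageTBoxBlock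

open scoped Real
open Literature.MathematicalPhysics.QuantumLattice (su2Quat)
open Literature.MathematicalPhysics.QuantumFieldTheory.Balaban1983to89
open T4CubeChartGnomonic (SU2)
open T4HaarSU2ExpChart (expPoint)
open T4ExpWindowSmallField (logVec)
open Summit.QuantumFields.YangMills.Theorems.FluctuationComparisonRegPrIntLS2BetaBlockOffsetCoordinates (read_tgt_eq)
open Summit.QuantumFields.YangMills.Theorems.FluctuationComparisonRegPrIntLS2BetaSqrtGaugeStageTBlock
  (uu_apply_fst uu_apply_snd uu_apply_of_ne uu_mem_slice uu_step_fst uu_step_snd uu_step_of_ne slice_step_fst slice_step_snd)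

variable {P : Params} {j : ℕ}

section StageTBox

variable (φ : (Fin P.d → ℕ) → SU2) (a : SU2) (α β : Fin P.d) (nα nβ : ℕ) (r : ℝ)
  (Wr : (ℕ × ℕ → SU2) → (ℕ × ℕ → SU2))
  (hWr : ∀ ψ : ℕ × ℕ → SU2,
      (∀ i k, i ≤ nα → k ≤ nβ → (i = 0 ∨ i = nα ∨ k = 0 ∨ k = nβ) → ‖logVec (su2Quat (a⁻¹ * ψ (i, k)))‖ ≤ π - r) →
      (∀ i k, i ≤ nα → k ≤ nβ → (i = 0 ∨ i = nα ∨ k = 0 ∨ k = nβ) → Wr ψ (i, k) = ψ (i, k)) ∧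
      (∀ i k, i ≤ nα → k ≤ nβ → ‖logVec (su2Quat (a⁻¹ * Wr ψ (i, k)))‖ ≤ π - r) ∧
      (∀ η : ℝ, 0 ≤ η →
        (∀ i k, i + 1 ≤ nα → k ≤ nβ → (i = 0 ∨ i = nα ∨ k = 0 ∨ k = nβ) → (i + 1 = nα ∨ k = 0 ∨ k = nβ) →
          dist1 (ψ (i, k) * (ψ (i + 1, k))⁻¹) ≤ η) →
        (∀ i k, i ≤ nα → k + 1 ≤ nβ → (i = 0 ∨ i = nα ∨ k = 0 ∨ k = nβ) → (i = 0 ∨ i = nα ∨ k + 1 = nβ) →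
          dist1 (ψ (i, k) * (ψ (i, k + 1))⁻¹) ≤ η) →
        (∀ i k, i + 1 ≤ nα → k ≤ nβ →
          dist1 (Wr ψ (i, k) * (Wr ψ (i + 1, k))⁻¹) ≤ 12 * ((π - r) / Real.sin r) * η + 6 * (π - r) / nα) ∧
        (∀ i k, i ≤ nα → k + 1 ≤ nβ →
          dist1 (Wr ψ (i, k) * (Wr ψ (i, k + 1))⁻¹) ≤ 12 * ((π - r) / Real.sin r) * η + 6 * (π - r) / nα)) ∧
      (∀ ψ' : ℕ × ℕ → SU2, ∀ μ : ℝ,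
        (∀ i k, i ≤ nα → k ≤ nβ → (i = 0 ∨ i = nα ∨ k = 0 ∨ k = nβ) → ‖logVec (su2Quat (a⁻¹ * ψ' (i, k)))‖ ≤ π - r) →
        (∀ i k, i ≤ nα → k ≤ nβ → (i = 0 ∨ i = nα ∨ k = 0 ∨ k = nβ) → dist1 (ψ (i, k) * (ψ' (i, k))⁻¹) ≤ μ) →
        ∀ i k, i ≤ nα → k ≤ nβ → dist1 (Wr ψ (i, k) * (Wr ψ' (i, k))⁻¹) ≤ ((π - r) / Real.sin r) * μ))
  (W : (Fin P.d → ℕ) → SU2)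
  (hW : ∀ t : Fin P.d → ℕ, W t = Wr (fun p => φ (Function.update (Function.update t α p.1) β p.2)) (t α, t β))

/-! ## §1 Readers: ring cap and ring letters of the slice datum from offset-level hypotheses -/

/-- The ring cap of the slice of `t`, read as the cap hypothesis of (R2) for the slice datum `ψ_t`. [folklore] -/
theorem sliceCap_of_ringCap (hαβ : α ≠ β) (t : Fin P.d → ℕ)
    (hcap : ∀ u : Fin P.d → ℕ, Function.update (Function.update u α (t α)) β (t β) = t → u α ≤ nα → u β ≤ nβ →
      (u α = 0 ∨ u α = nα ∨ u β = 0 ∨ u β = nβ) → ‖logVec (su2Quat (a⁻¹ * φ u))‖ ≤ π - r) :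
    ∀ i k, i ≤ nα → k ≤ nβ → (i = 0 ∨ i = nα ∨ k = 0 ∨ k = nβ) →
      ‖logVec (su2Quat (a⁻¹ * (fun p : ℕ × ℕ => φ (Function.update (Function.update t α p.1) β p.2)) (i, k)))‖ ≤ π - r := by
  intro i k hi hk hb
  have h := hcap (Function.update (Function.update t α i) β k) (uu_mem_slice t hαβ i k)
  rw [uu_apply_fst t hαβ, uu_apply_snd] at h
  exact h hi hk hb

/-- The forward HORIZONTAL ring letters of the slice datum from the offset-level per-bond hypothesis. [folklore] -/
theorem sliceRing_h_of_ringSteps (hαβ : α ≠ β) (t : Fin P.d → ℕ) {η : ℝ}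
    (hstep : ∀ u : Fin P.d → ℕ, ∀ κ : Fin P.d, (κ = α ∨ κ = β) → Function.update (Function.update u α (t α)) β (t β) = t →
      u α ≤ nα → u β ≤ nβ → (u α = 0 ∨ u α = nα ∨ u β = 0 ∨ u β = nβ) →
      Function.update u κ (u κ + 1) α ≤ nα → Function.update u κ (u κ + 1) β ≤ nβ →
      (Function.update u κ (u κ + 1) α = 0 ∨ Function.update u κ (u κ + 1) α = nα ∨
        Function.update u κ (u κ + 1) β = 0 ∨ Function.update u κ (u κ + 1) β = nβ) →
      dist1 (φ u * (φ (Function.update u κ (u κ + 1)))⁻¹) ≤ η) :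
    ∀ i k, i + 1 ≤ nα → k ≤ nβ → (i = 0 ∨ i = nα ∨ k = 0 ∨ k = nβ) → (i + 1 = nα ∨ k = 0 ∨ k = nβ) →
      dist1 ((fun p : ℕ × ℕ => φ (Function.update (Function.update t α p.1) β p.2)) (i, k) *
        ((fun p : ℕ × ℕ => φ (Function.update (Function.update t α p.1) β p.2)) (i + 1, k))⁻¹) ≤ η := by
  intro i k hi hk hb hb'
  have h := hstep (Function.update (Function.update t α i) β k) α (Or.inl rfl) (uu_mem_slice t hαβ i k)
  rw [uu_step_fst t hαβ, uu_apply_fst t hαβ, uu_apply_snd, uu_apply_fst t hαβ, uu_apply_snd] at h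
  exact h (by omega) hk hb hi hk (Or.inr hb')

/-- The forward VERTICAL ring letters of the slice datum from the offset-level per-bond hypothesis. [folklore] -/
theorem sliceRing_v_of_ringSteps (hαβ : α ≠ β) (t : Fin P.d → ℕ) {η : ℝ}
    (hstep : ∀ u : Fin P.d → ℕ, ∀ κ : Fin P.d, (κ = α ∨ κ = β) → Function.update (Function.update u α (t α)) β (t β) = t →
      u α ≤ nα → u β ≤ nβ → (u α = 0 ∨ u α = nα ∨ u β = 0 ∨ u β = nβ) →
      Function.update u κ (u κ + 1) α ≤ nα → Function.update u κ (u κ + 1) β ≤ nβ →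
      (Function.update u κ (u κ + 1) α = 0 ∨ Function.update u κ (u κ + 1) α = nα ∨
        Function.update u κ (u κ + 1) β = 0 ∨ Function.update u κ (u κ + 1) β = nβ) →
      dist1 (φ u * (φ (Function.update u κ (u κ + 1)))⁻¹) ≤ η) :
    ∀ i k, i ≤ nα → k + 1 ≤ nβ → (i = 0 ∨ i = nα ∨ k = 0 ∨ k = nβ) → (i = 0 ∨ i = nα ∨ k + 1 = nβ) →
      dist1 ((fun p : ℕ × ℕ => φ (Function.update (Function.update t α p.1) β p.2)) (i, k) *
        ((fun p : ℕ × ℕ => φ (Function.update (Function.update t α p.1) β p.2)) (i, k + 1))⁻¹) ≤ η := by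
  intro i k hi hk hb hb'
  have h := hstep (Function.update (Function.update t α i) β k) β (Or.inr rfl) (uu_mem_slice t hαβ i k)
  rw [uu_step_snd t α β, uu_apply_fst t hαβ, uu_apply_snd, uu_apply_fst t hαβ, uu_apply_snd] at h
  exact h hi (by omega) hb hi hk (by rcases hb' with h' | h' | h' <;> simp [h'])

/-! ## §2 Offset-level laws -/

include hW hWr in
/-- ★ **THE RING AGREEMENT** ((DESC₂) of ADD.1): on the ring of its slice (`t α ≤ nα`, `t β ≤ nβ`, `t α ∈ {0,nα} ∨ t β ∈ {0,nβ}`), with the slice's ring data inside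
the cap of `a`, the section is the datum: `W t = φ t` ((R2) (i)). [folklore] -/
theorem stageT_ring_eq (hαβ : α ≠ β) (t : Fin P.d → ℕ) (hα : t α ≤ nα) (hβ : t β ≤ nβ) (hring : t α = 0 ∨ t α = nα ∨ t β = 0 ∨ t β = nβ)
    (hcap : ∀ u : Fin P.d → ℕ, Function.update (Function.update u α (t α)) β (t β) = t → u α ≤ nα → u β ≤ nβ →
      (u α = 0 ∨ u α = nα ∨ u β = 0 ∨ u β = nβ) → ‖logVec (su2Quat (a⁻¹ * φ u))‖ ≤ π - r) :
    W t = φ t := by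
  rw [hW t, (hWr (fun p => φ (Function.update (Function.update t α p.1) β p.2))
    (sliceCap_of_ringCap φ a α β nα nβ r hαβ t hcap)).1 (t α) (t β) hα hβ hring]
  simp only [Function.update_eq_self]

include hW hWr in
/-- ★★ **THE CAP POSITION**: everywhere on the rectangle of its slice (`t α ≤ nα`, `t β ≤ nβ`), with the slice's ring data inside the cap of `a`:
`‖logVec (a⁻¹·W t)‖ ≤ π − r` ((R2) (ii)). [folklore] -/
theorem norm_logVec_inv_stageT_le (hαβ : α ≠ β) (t : Fin P.d → ℕ) (hα : t α ≤ nα) (hβ : t β ≤ nβ)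
    (hcap : ∀ u : Fin P.d → ℕ, Function.update (Function.update u α (t α)) β (t β) = t → u α ≤ nα → u β ≤ nβ →
      (u α = 0 ∨ u α = nα ∨ u β = 0 ∨ u β = nβ) → ‖logVec (su2Quat (a⁻¹ * φ u))‖ ≤ π - r) :
    ‖logVec (su2Quat (a⁻¹ * W t))‖ ≤ π - r := by
  rw [hW t]
  exact (hWr (fun p => φ (Function.update (Function.update t α p.1) β p.2))
    (sliceCap_of_ringCap φ a α β nα nβ r hαβ t hcap)).2.1 (t α) (t β) hα hβ

include hW hWr in
/-- ★★★ **THE IN-SLICE `α`-STEP**: for an offset vector `t` with `t α + 1 ≤ nα`, `t β ≤ nβ`, the slice's ring data inside the cap of `a` and with PER-BOND ring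
oscillation `≤ η`: `dist1 (W t·(W (update t α (t α + 1)))⁻¹) ≤ 12·((π−r)∕sin r)·η + 6(π−r)∕nα` ((R2) (iii′)). [cite: Balaban1985RegularSpaces, Thm 2 p.83] -/
theorem dist1_stageT_step_fst_le (hαβ : α ≠ β) (t : Fin P.d → ℕ) (hα : t α + 1 ≤ nα) (hβ : t β ≤ nβ)
    (hcap : ∀ u : Fin P.d → ℕ, Function.update (Function.update u α (t α)) β (t β) = t → u α ≤ nα → u β ≤ nβ →
      (u α = 0 ∨ u α = nα ∨ u β = 0 ∨ u β = nβ) → ‖logVec (su2Quat (a⁻¹ * φ u))‖ ≤ π - r)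
    {η : ℝ} (hη : 0 ≤ η)
    (hstep : ∀ u : Fin P.d → ℕ, ∀ κ : Fin P.d, (κ = α ∨ κ = β) → Function.update (Function.update u α (t α)) β (t β) = t →
      u α ≤ nα → u β ≤ nβ → (u α = 0 ∨ u α = nα ∨ u β = 0 ∨ u β = nβ) →
      Function.update u κ (u κ + 1) α ≤ nα → Function.update u κ (u κ + 1) β ≤ nβ →
      (Function.update u κ (u κ + 1) α = 0 ∨ Function.update u κ (u κ + 1) α = nα ∨
        Function.update u κ (u κ + 1) β = 0 ∨ Function.update u κ (u κ + 1) β = nβ) →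
      dist1 (φ u * (φ (Function.update u κ (u κ + 1)))⁻¹) ≤ η) :
    dist1 (W t * (W (Function.update t α (t α + 1)))⁻¹) ≤ 12 * ((π - r) / Real.sin r) * η + 6 * (π - r) / nα := by
  rw [hW t, hW (Function.update t α (t α + 1)), slice_step_fst φ t α β, Function.update_self, Function.update_of_ne (Ne.symm hαβ)]
  exact ((hWr (fun p => φ (Function.update (Function.update t α p.1) β p.2))
    (sliceCap_of_ringCap φ a α β nα nβ r hαβ t hcap)).2.2.1 η hη
    (sliceRing_h_of_ringSteps φ α β nα nβ hαβ t hstep) (sliceRing_v_of_ringSteps φ α β nα nβ hαβ t hstep)).1 (t α) (t β) hα hβ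

include hW hWr in
/-- ★★★ **THE IN-SLICE `β`-STEP**: as `dist1_stageT_step_fst_le` with `t α ≤ nα`, `t β + 1 ≤ nβ`. [cite: Balaban1985RegularSpaces, Thm 2 p.83] -/
theorem dist1_stageT_step_snd_le (hαβ : α ≠ β) (t : Fin P.d → ℕ) (hα : t α ≤ nα) (hβ : t β + 1 ≤ nβ)
    (hcap : ∀ u : Fin P.d → ℕ, Function.update (Function.update u α (t α)) β (t β) = t → u α ≤ nα → u β ≤ nβ →
      (u α = 0 ∨ u α = nα ∨ u β = 0 ∨ u β = nβ) → ‖logVec (su2Quat (a⁻¹ * φ u))‖ ≤ π - r)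
    {η : ℝ} (hη : 0 ≤ η)
    (hstep : ∀ u : Fin P.d → ℕ, ∀ κ : Fin P.d, (κ = α ∨ κ = β) → Function.update (Function.update u α (t α)) β (t β) = t →
      u α ≤ nα → u β ≤ nβ → (u α = 0 ∨ u α = nα ∨ u β = 0 ∨ u β = nβ) →
      Function.update u κ (u κ + 1) α ≤ nα → Function.update u κ (u κ + 1) β ≤ nβ →
      (Function.update u κ (u κ + 1) α = 0 ∨ Function.update u κ (u κ + 1) α = nα ∨
        Function.update u κ (u κ + 1) β = 0 ∨ Function.update u κ (u κ + 1) β = nβ) →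
      dist1 (φ u * (φ (Function.update u κ (u κ + 1)))⁻¹) ≤ η) :
    dist1 (W t * (W (Function.update t β (t β + 1)))⁻¹) ≤ 12 * ((π - r) / Real.sin r) * η + 6 * (π - r) / nα := by
  rw [hW t, hW (Function.update t β (t β + 1)), slice_step_snd φ t hαβ, Function.update_self, Function.update_of_ne hαβ]
  exact ((hWr (fun p => φ (Function.update (Function.update t α p.1) β p.2))
    (sliceCap_of_ringCap φ a α β nα nβ r hαβ t hcap)).2.2.1 η hη
    (sliceRing_h_of_ringSteps φ α β nα nβ hαβ t hstep) (sliceRing_v_of_ringSteps φ α β nα nβ hαβ t hstep)).2 (t α) (t β) hα hβ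

include hW hWr in
/-- ★★★ **THE ACROSS-SLICE STEP**: for `γ ∉ {α, β}`, `t α ≤ nα`, `t β ≤ nβ`, ring data of BOTH slices (`t` and `update t γ (t γ + 1)`) inside the cap of `a` and the
data's `γ`-bonds through the ring of `t` of oscillation `≤ μ`: `dist1 (W t·(W (update t γ (t γ + 1)))⁻¹) ≤ ((π−r)∕sin r)·μ` ((R2) (iv)). [cite: Balaban1985RegularSpaces, Thm 2 p.83] -/
theorem dist1_stageT_step_of_ne_le (hαβ : α ≠ β) {γ : Fin P.d} (hγα : γ ≠ α) (hγβ : γ ≠ β) (t : Fin P.d → ℕ) (hα : t α ≤ nα) (hβ : t β ≤ nβ)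
    (hcap : ∀ u : Fin P.d → ℕ, Function.update (Function.update u α (t α)) β (t β) = t → u α ≤ nα → u β ≤ nβ →
      (u α = 0 ∨ u α = nα ∨ u β = 0 ∨ u β = nβ) → ‖logVec (su2Quat (a⁻¹ * φ u))‖ ≤ π - r)
    (hcap' : ∀ u : Fin P.d → ℕ, Function.update (Function.update u α (t α)) β (t β) = Function.update t γ (t γ + 1) → u α ≤ nα → u β ≤ nβ →
      (u α = 0 ∨ u α = nα ∨ u β = 0 ∨ u β = nβ) → ‖logVec (su2Quat (a⁻¹ * φ u))‖ ≤ π - r)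
    {μ : ℝ}
    (hclose : ∀ u : Fin P.d → ℕ, Function.update (Function.update u α (t α)) β (t β) = t → u α ≤ nα → u β ≤ nβ →
      (u α = 0 ∨ u α = nα ∨ u β = 0 ∨ u β = nβ) → dist1 (φ u * (φ (Function.update u γ (u γ + 1)))⁻¹) ≤ μ) :
    dist1 (W t * (W (Function.update t γ (t γ + 1)))⁻¹) ≤ ((π - r) / Real.sin r) * μ := by
  rw [hW t, hW (Function.update t γ (t γ + 1)), Function.update_of_ne (Ne.symm hγα), Function.update_of_ne (Ne.symm hγβ)]
  have hcapψ' : ∀ i k, i ≤ nα → k ≤ nβ → (i = 0 ∨ i = nα ∨ k = 0 ∨ k = nβ) →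
      ‖logVec (su2Quat (a⁻¹ * (fun p : ℕ × ℕ => φ (Function.update (Function.update (Function.update t γ (t γ + 1)) α p.1) β p.2)) (i, k)))‖ ≤ π - r := by
    have hα' : Function.update t γ (t γ + 1) α = t α := Function.update_of_ne (Ne.symm hγα) ..
    have hβ' : Function.update t γ (t γ + 1) β = t β := Function.update_of_ne (Ne.symm hγβ) ..
    exact sliceCap_of_ringCap φ a α β nα nβ r hαβ (Function.update t γ (t γ + 1)) (by rw [hα', hβ']; exact hcap')
  refine (hWr (fun p => φ (Function.update (Function.update t α p.1) β p.2))
    (sliceCap_of_ringCap φ a α β nα nβ r hαβ t hcap)).2.2.2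
    (fun p : ℕ × ℕ => φ (Function.update (Function.update (Function.update t γ (t γ + 1)) α p.1) β p.2)) μ hcapψ'
    (fun i k hi hk hb => ?_) (t α) (t β) hα hβ
  have h := hclose (Function.update (Function.update t α i) β k) (uu_mem_slice t hαβ i k)
  rw [uu_apply_fst t hαβ, uu_apply_snd, uu_apply_of_ne t hγα hγβ, uu_step_of_ne t hγα hγβ] at h
  exact h hi hk hb

/-! ## §3 Bond-level laws (sites, bonds, offsets as in (L-I)∕(L-T)) -/

variable (s : Fin P.d → ℕ)

include hW hWr in
/-- ★★★ **THE IN-SLICE BOND STEP**: along a bond `b` in direction `α` or `β` inside the rectangle of its slice (source offsets `t`, target offsets `≤ nα`∕`≤ nβ`, no wrap),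
with the slice's ring data inside the cap of `a` and of per-bond oscillation `≤ η`: `dist1 (W (t src)·(W (t tgt))⁻¹) ≤ 12·((π−r)∕sin r)·η + 6(π−r)∕nα`.
[cite: Balaban1985RegularSpaces, Thm 2 p.83] -/
theorem dist1_stageT_inslice_le (hαβ : α ≠ β) (b : PBond P j) (hdir : b.dir = α ∨ b.dir = β)
    (hN : (b.src b.dir - ((s b.dir : ℕ) : ZMod (P.sitesPerDir j))).val + 1 < P.sitesPerDir j)
    (htgtα : Function.update (fun κ => (b.src κ - ((s κ : ℕ) : ZMod (P.sitesPerDir j))).val) b.dir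
        ((b.src b.dir - ((s b.dir : ℕ) : ZMod (P.sitesPerDir j))).val + 1) α ≤ nα)
    (htgtβ : Function.update (fun κ => (b.src κ - ((s κ : ℕ) : ZMod (P.sitesPerDir j))).val) b.dir
        ((b.src b.dir - ((s b.dir : ℕ) : ZMod (P.sitesPerDir j))).val + 1) β ≤ nβ)
    (hcap : ∀ u : Fin P.d → ℕ,
      Function.update (Function.update u α ((b.src α - ((s α : ℕ) : ZMod (P.sitesPerDir j))).val))
          β ((b.src β - ((s β : ℕ) : ZMod (P.sitesPerDir j))).val) = (fun κ => (b.src κ - ((s κ : ℕ) : ZMod (P.sitesPerDir j))).val) →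
      u α ≤ nα → u β ≤ nβ → (u α = 0 ∨ u α = nα ∨ u β = 0 ∨ u β = nβ) → ‖logVec (su2Quat (a⁻¹ * φ u))‖ ≤ π - r)
    {η : ℝ} (hη : 0 ≤ η)
    (hstep : ∀ u : Fin P.d → ℕ, ∀ κ : Fin P.d, (κ = α ∨ κ = β) →
      Function.update (Function.update u α ((b.src α - ((s α : ℕ) : ZMod (P.sitesPerDir j))).val))
          β ((b.src β - ((s β : ℕ) : ZMod (P.sitesPerDir j))).val) = (fun κ => (b.src κ - ((s κ : ℕ) : ZMod (P.sitesPerDir j))).val) →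
      u α ≤ nα → u β ≤ nβ → (u α = 0 ∨ u α = nα ∨ u β = 0 ∨ u β = nβ) →
      Function.update u κ (u κ + 1) α ≤ nα → Function.update u κ (u κ + 1) β ≤ nβ →
      (Function.update u κ (u κ + 1) α = 0 ∨ Function.update u κ (u κ + 1) α = nα ∨
        Function.update u κ (u κ + 1) β = 0 ∨ Function.update u κ (u κ + 1) β = nβ) →
      dist1 (φ u * (φ (Function.update u κ (u κ + 1)))⁻¹) ≤ η) :
    dist1 (W (fun κ => (b.src κ - ((s κ : ℕ) : ZMod (P.sitesPerDir j))).val) *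
      (W (fun κ => (b.tgt κ - ((s κ : ℕ) : ZMod (P.sitesPerDir j))).val))⁻¹) ≤ 12 * ((π - r) / Real.sin r) * η + 6 * (π - r) / nα := by
  rw [read_tgt_eq W s b hN]
  set t : Fin P.d → ℕ := fun κ => (b.src κ - ((s κ : ℕ) : ZMod (P.sitesPerDir j))).val with ht
  rcases hdir with hdir | hdir
  · rw [hdir] at htgtα htgtβ ⊢
    rw [Function.update_self] at htgtα
    rw [Function.update_of_ne (Ne.symm hαβ)] at htgtβ
    exact dist1_stageT_step_fst_le φ a α β nα nβ r Wr hWr W hW hαβ t htgtα htgtβ hcap hη hstep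
  · rw [hdir] at htgtα htgtβ ⊢
    rw [Function.update_of_ne hαβ] at htgtα
    rw [Function.update_self] at htgtβ
    exact dist1_stageT_step_snd_le φ a α β nα nβ r Wr hWr W hW hαβ t htgtα htgtβ hcap hη hstep

include hW hWr in
/-- ★★★ **THE TRANSVERSE BOND STEP**: along a bond `b` in a direction `∉ {α, β}` (source offsets `t` with `t α ≤ nα`, `t β ≤ nβ`, no wrap), with the ring data of both
slices inside the cap of `a` and the data's `b.dir`-bonds through the ring of oscillation `≤ μ`: `dist1 (W (t src)·(W (t tgt))⁻¹) ≤ ((π−r)∕sin r)·μ`.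
[cite: Balaban1985RegularSpaces, Thm 2 p.83] -/
theorem dist1_stageT_transverse_le (hαβ : α ≠ β) (b : PBond P j) (hγα : b.dir ≠ α) (hγβ : b.dir ≠ β)
    (hN : (b.src b.dir - ((s b.dir : ℕ) : ZMod (P.sitesPerDir j))).val + 1 < P.sitesPerDir j)
    (hα : (b.src α - ((s α : ℕ) : ZMod (P.sitesPerDir j))).val ≤ nα) (hβ : (b.src β - ((s β : ℕ) : ZMod (P.sitesPerDir j))).val ≤ nβ)
    (hcap : ∀ u : Fin P.d → ℕ,
      Function.update (Function.update u α ((b.src α - ((s α : ℕ) : ZMod (P.sitesPerDir j))).val))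
          β ((b.src β - ((s β : ℕ) : ZMod (P.sitesPerDir j))).val) = (fun κ => (b.src κ - ((s κ : ℕ) : ZMod (P.sitesPerDir j))).val) →
      u α ≤ nα → u β ≤ nβ → (u α = 0 ∨ u α = nα ∨ u β = 0 ∨ u β = nβ) → ‖logVec (su2Quat (a⁻¹ * φ u))‖ ≤ π - r)
    (hcap' : ∀ u : Fin P.d → ℕ,
      Function.update (Function.update u α ((b.src α - ((s α : ℕ) : ZMod (P.sitesPerDir j))).val))
          β ((b.src β - ((s β : ℕ) : ZMod (P.sitesPerDir j))).val) =
        Function.update (fun κ => (b.src κ - ((s κ : ℕ) : ZMod (P.sitesPerDir j))).val) b.dir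
          ((b.src b.dir - ((s b.dir : ℕ) : ZMod (P.sitesPerDir j))).val + 1) →
      u α ≤ nα → u β ≤ nβ → (u α = 0 ∨ u α = nα ∨ u β = 0 ∨ u β = nβ) → ‖logVec (su2Quat (a⁻¹ * φ u))‖ ≤ π - r)
    {μ : ℝ}
    (hclose : ∀ u : Fin P.d → ℕ,
      Function.update (Function.update u α ((b.src α - ((s α : ℕ) : ZMod (P.sitesPerDir j))).val))
          β ((b.src β - ((s β : ℕ) : ZMod (P.sitesPerDir j))).val) = (fun κ => (b.src κ - ((s κ : ℕ) : ZMod (P.sitesPerDir j))).val) →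
      u α ≤ nα → u β ≤ nβ → (u α = 0 ∨ u α = nα ∨ u β = 0 ∨ u β = nβ) → dist1 (φ u * (φ (Function.update u b.dir (u b.dir + 1)))⁻¹) ≤ μ) :
    dist1 (W (fun κ => (b.src κ - ((s κ : ℕ) : ZMod (P.sitesPerDir j))).val) *
      (W (fun κ => (b.tgt κ - ((s κ : ℕ) : ZMod (P.sitesPerDir j))).val))⁻¹) ≤ ((π - r) / Real.sin r) * μ := by
  rw [read_tgt_eq W s b hN]
  exact dist1_stageT_step_of_ne_le φ a α β nα nβ r Wr hWr W hW hαβ hγα hγβ _ hα hβ hcap hcap' hclose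

end StageTBox

end Summit.QuantumFields.YangMills.Theorems.FluctuationComparisonRegPrIntLS2BetaSqrtGaugeStageTBoxBlock

end
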